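import Literature.Analysis.FluidPDE.MollifiedSolenoidalTest
import HarnessLib

/-!
# Tools for mollified time slices: adjointness, versions, joint measurability

Analysis/FluidPDE support file (serves the discharge of the barrier fact
`Literature.Barriers.AnomalousDissipation.BrenierDeLellisSzekelyhidi2011_cor1`, Brenier–De Lellis–
Székelyhidi 2011, Cor. 1: the cross identity between a Leray–Hopf solution `u` and the Euler
solution `v` is obtained by Serrin's doubling of the time variable applied to
`Q(s,σ) = ⟨u(s), φ ⋆ v(σ)⟩ = ⟨φ ⋆ u(s), v(σ)⟩`). Elementary facts about the spatial
mollification `φ ⋆ ·` of time-dependent fields needed there: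

* `integral_inner_normed_convolution_comm`: `∫ ⟪f, φ ⋆ g⟫ = ∫ ⟪φ ⋆ f, g⟫` for `f, g ∈ L²`
  (the bump kernel is even; Fubini);
* `convolution_lsmul_congr_ae_right`: `k ⋆ f = k ⋆ g` pointwise when `f = g` a.e.;
* `stronglyMeasurable_uncurry_convolution_lsmul`: `(s, x) ↦ (k ⋆ W s)(x)` is jointly measurable
  for a jointly measurable `W` and a continuous compactly supported kernel `k`;
* `ContinuousInLpOn.normed_convolution`: `φ ⋆ v ∈ C(S; L²)` when `v ∈ C(S; L²)`;
* `IsLerayHopfOn.eLpNorm_le_eLpNorm_datum`: `‖u(s)‖_{L²} ≤ ‖u₀‖_{L²}` on `[0,T]` for an unforced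
  Leray–Hopf solution with `ν ≥ 0` (energy inequality);
* `inner_clm_apply_self_eq_sum`: `⟪a, L a⟫ = Σᵢ ⟪⟪a, bᵢ⟫ a, L bᵢ⟫` in an orthonormal frame.

## Mathlib / tree search

Mathlib: convolution (`MeasureTheory.convolution`, `convolution_lsmul_swap`), Fubini
(`integrable_prod_iff`, `integral_integral_swap`), `StronglyMeasurable.integral_prod_right'`.
Tree: `MollifiedField.integral_smul_convolution_eq` is the adjoint identity for a *scalar,
compactly supported* weight; the `L² × L²` vector version is proved here. The other items are
routine glue not found in the tree (searched `convolution_congr`, `uncurry.*convolution`,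
`ContinuousInLpOn.*convolution`).

## References

* L. C. Evans, *Partial Differential Equations*, 2nd ed. (2010), App. C.4 (mollifiers). [Evans2010]
-/

noncomputable section

open MeasureTheory TopologicalSpace Set Function Filter ContinuousLinearMap
open scoped ENNReal NNReal Convolution InnerProductSpace RealInnerProductSpace Topology

namespace Literature.Analysis.FluidPDE

variable {E : Type*} [NormedAddCommGroup E] [InnerProductSpace ℝ E] [FiniteDimensional ℝ E]
  [MeasurableSpace E] [BorelSpace E]

/-! ### Convolution and a.e. modification; joint measurability -/

section Measurability

variable {F : Type*} [NormedAddCommGroup F] [NormedSpace ℝ F]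

/-- The convolution only sees the a.e. class of the field: `k ⋆ f = k ⋆ g` pointwise when
`f = g` a.e. (translation invariance of Lebesgue measure). [folklore] -/
theorem convolution_lsmul_congr_ae_right (k : E → ℝ) {f g : E → F} (h : f =ᵐ[volume] g) (x : E) :
    (k ⋆[lsmul ℝ ℝ, volume] f) x = (k ⋆[lsmul ℝ ℝ, volume] g) x := by
  rw [convolution_def, convolution_def]
  refine integral_congr_ae ?_
  have h' : (fun t => f (x - t)) =ᵐ[volume] fun t => g (x - t) :=
    h.comp_tendsto (Measure.measurePreserving_sub_left volume x).quasiMeasurePreserving.tendsto_ae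
  filter_upwards [h'] with t ht
  simp only [lsmul_apply, ht]

variable {X : Type*} [MeasurableSpace X]

/-- **Joint measurability of slice-wise convolutions.** For a jointly strongly measurable
`W : X × E → F` and a continuous kernel `k`, the field `(s, x) ↦ (k ⋆ W s)(x) = ∫ k(t) W(s, x - t) dt`
is jointly strongly measurable (a parametric integral of a jointly measurable integrand). [folklore] -/
theorem stronglyMeasurable_uncurry_convolution_lsmul {k : E → ℝ} (hk : Continuous k)
    {W : X → E → F} (hW : StronglyMeasurable (uncurry W)) :
    StronglyMeasurable (uncurry fun s x => (k ⋆[lsmul ℝ ℝ, volume] W s) x) := by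
  have h1 : StronglyMeasurable fun q : (X × E) × E => k q.2 • W q.1.1 (q.1.2 - q.2) := by
    have hc : StronglyMeasurable fun q : (X × E) × E => k q.2 :=
      (hk.measurable.comp measurable_snd).stronglyMeasurable
    have hm : StronglyMeasurable fun q : (X × E) × E => W q.1.1 (q.1.2 - q.2) :=
      hW.comp_measurable (measurable_fst.fst.prodMk (measurable_fst.snd.sub measurable_snd))
    exact hc.smul hm
  have h2 := h1.integral_prod_right' (ν := (volume : Measure E))
  have heq : (uncurry fun s x => (k ⋆[lsmul ℝ ℝ, volume] W s) x) =
      fun z : X × E => ∫ t, k t • W z.1 (z.2 - t) := by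
    funext z
    simp only [uncurry, convolution_def, lsmul_apply]
  rw [heq]
  exact h2

end Measurability

/-! ### Adjointness of mollification on `L² × L²` -/

section Adjoint

variable {V : Type*} [NormedAddCommGroup V] [InnerProductSpace ℝ V] [CompleteSpace V]

/-- **Mollification with a bump kernel is symmetric on `L²`**: `∫ ⟪f, φ ⋆ g⟫ = ∫ ⟪φ ⋆ f, g⟫`
for `f, g ∈ L²(E; V)` (the kernel `φ.normed` is even; Fubini on
`(x, y) ↦ φ(x - y) ⟪f x, g y⟫`, integrable since `∫ |f| (φ ⋆ |g|) ≤ ‖f‖₂ ‖g‖₂`). [folklore] -/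
theorem integral_inner_normed_convolution_comm (φ : ContDiffBump (0 : E)) {f g : E → V}
    (hf : MemLp f 2 volume) (hg : MemLp g 2 volume) :
    ∫ x, ⟪f x, (φ.normed volume ⋆[lsmul ℝ ℝ, volume] g) x⟫ =
      ∫ y, ⟪(φ.normed volume ⋆[lsmul ℝ ℝ, volume] f) y, g y⟫ := by
  set ρ : E → ℝ := φ.normed volume with hρ
  have hρc : Continuous ρ := φ.continuous_normed
  have hρs : HasCompactSupport ρ := φ.hasCompactSupport_normed
  have hρ0 : ∀ z, 0 ≤ ρ z := fun z => φ.nonneg_normed z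
  have hρe : ∀ z, ρ (-z) = ρ z := fun z => φ.normed_neg z
  have hfl : LocallyIntegrable f volume := hf.locallyIntegrable one_le_two
  have hgl : LocallyIntegrable g volume := hg.locallyIntegrable one_le_two
  -- the two-variable integrand
  set H : E × E → ℝ := fun p => ρ (p.1 - p.2) * ⟪f p.1, g p.2⟫ with hH
  have hHm : AEStronglyMeasurable H ((volume : Measure E).prod volume) := by
    refine ((hρc.comp (continuous_fst.sub continuous_snd)).aestronglyMeasurable).mul ?_
    exact hf.1.comp_fst.inner hg.1.comp_snd
  -- slice integrability and the outer majorant `|f x| (ρ ⋆ ‖g‖)(x)`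
  have hgn2 : MemLp (fun y => ‖g y‖) 2 volume := hg.norm
  have hconv := FunctionSpaces.memLp_normed_convolution φ hgn2 one_le_two
  have hslice : ∀ x, Integrable (fun y => H (x, y)) volume := fun x => by
    have h1 : Integrable (fun y => ρ (x - y) • g y) volume :=
      integrable_comp_sub_smul hρc hρs hgl x
    have h2 : Integrable (fun y => ⟪f x, ρ (x - y) • g y⟫) volume := h1.const_inner (f x)
    refine h2.congr (ae_of_all _ fun y => ?_)
    simp only [hH, real_inner_smul_right]
  have hnorm : ∀ x, ∫ y, ‖H (x, y)‖ ≤ ‖f x‖ * (ρ ⋆[lsmul ℝ ℝ, volume] fun y => ‖g y‖) x := by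
    intro x
    have h1 : Integrable (fun y => ρ (x - y) • ‖g y‖) volume :=
      integrable_comp_sub_smul hρc hρs (hgn2.locallyIntegrable one_le_two) x
    rw [convolution_lsmul_swap, ← integral_const_mul]
    refine integral_mono_of_nonneg (ae_of_all _ fun y => norm_nonneg _) (h1.const_mul _)
      (ae_of_all _ fun y => ?_)
    simp only [hH, norm_mul, Real.norm_eq_abs, abs_of_nonneg (hρ0 _), smul_eq_mul]
    calc ρ (x - y) * |⟪f x, g y⟫| ≤ ρ (x - y) * (‖f x‖ * ‖g y‖) :=
          mul_le_mul_of_nonneg_left (abs_real_inner_le_norm _ _) (hρ0 _)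
      _ = ‖f x‖ * (ρ (x - y) * ‖g y‖) := by ring
  have hmaj : Integrable (fun x => ‖f x‖ * (ρ ⋆[lsmul ℝ ℝ, volume] fun y => ‖g y‖) x) volume := by
    have h2 : MemLp ((fun x => ‖f x‖) * (ρ ⋆[lsmul ℝ ℝ, volume] fun y => ‖g y‖)) 1 volume :=
      hconv.mul hf.norm
    rw [memLp_one_iff_integrable] at h2
    exact h2
  have hHi : Integrable H ((volume : Measure E).prod volume) := by
    rw [integrable_prod_iff hHm]
    refine ⟨ae_of_all _ hslice, ?_⟩
    refine hmaj.mono' hHm.norm.integral_prod_right' (ae_of_all _ fun x => ?_)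
    rw [Real.norm_eq_abs, abs_of_nonneg (integral_nonneg fun y => norm_nonneg _)]
    exact hnorm x
  -- left side as an iterated integral
  have hL : ∫ x, ⟪f x, (ρ ⋆[lsmul ℝ ℝ, volume] g) x⟫ = ∫ x, ∫ y, H (x, y) := by
    refine integral_congr_ae (ae_of_all _ fun x => ?_)
    dsimp only
    rw [convolution_lsmul_swap, ← integral_inner (integrable_comp_sub_smul hρc hρs hgl x)]
    refine integral_congr_ae (ae_of_all _ fun y => ?_)
    simp only [hH, real_inner_smul_right]
  -- right side as the swapped iterated integral
  have hR : ∫ y, ⟪(ρ ⋆[lsmul ℝ ℝ, volume] f) y, g y⟫ = ∫ y, ∫ x, H (x, y) := by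
    refine integral_congr_ae (ae_of_all _ fun y => ?_)
    dsimp only
    rw [convolution_lsmul_swap, real_inner_comm,
      ← integral_inner (integrable_comp_sub_smul hρc hρs hfl y)]
    refine integral_congr_ae (ae_of_all _ fun x => ?_)
    simp only [hH, real_inner_smul_right]
    rw [← neg_sub x y, hρe, real_inner_comm]
  rw [hL, hR]
  exact integral_integral_swap hHi

end Adjoint

/-! ### Continuity in `L²` of the mollified field; Leray–Hopf `L²` bound; a frame identity -/

section Misc

variable {F : Type*} [NormedAddCommGroup F] [NormedSpace ℝ F]

omit [FiniteDimensional ℝ E] in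
/-- **Mollification preserves continuity into `L²`**: if `v ∈ C(S; L²)` then
`φ ⋆ v ∈ C(S; L²)` (`‖φ ⋆ (v s - v s₀)‖₂ ≤ ‖v s - v s₀‖₂`). [folklore] -/
theorem ContinuousInLpOn.normed_convolution [FiniteDimensional ℝ E] {S : Set ℝ} {v : ℝ → E → F}
    (hc : ContinuousInLpOn S 2 v) (φ : ContDiffBump (0 : E)) :
    ContinuousInLpOn S 2 fun s => φ.normed volume ⋆[lsmul ℝ ℝ, volume] v s := by
  refine ⟨fun s hs => FunctionSpaces.memLp_normed_convolution φ (hc.1 s hs) one_le_two,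
    fun s₀ hs₀ => ?_⟩
  have hev : ∀ᶠ s in 𝓝[S] s₀, eLpNorm ((φ.normed volume ⋆[lsmul ℝ ℝ, volume] v s) -
      φ.normed volume ⋆[lsmul ℝ ℝ, volume] v s₀) 2 volume ≤ eLpNorm (v s - v s₀) 2 volume := by
    filter_upwards [eventually_mem_nhdsWithin] with s hs
    rw [← normed_convolution_sub φ ((hc.1 s hs).locallyIntegrable one_le_two)
      ((hc.1 s₀ hs₀).locallyIntegrable one_le_two)]
    exact FunctionSpaces.eLpNorm_normed_convolution_le φ ((hc.1 s hs).sub (hc.1 s₀ hs₀)).1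
      one_le_two
  exact tendsto_of_tendsto_of_tendsto_of_le_of_le' tendsto_const_nhds (hc.2 s₀ hs₀)
    (Eventually.of_forall fun _ => zero_le) hev

variable {T ν : ℝ} {u₀ : E → E} {u : ℝ → E → E}

/-- **Energy bound of an unforced Leray–Hopf solution**: `‖u(s)‖_{L²} ≤ ‖u₀‖_{L²}` for every
`s ∈ [0, T]` when `ν ≥ 0` and `u₀ ∈ L²` (the energy inequality from `0` with zero force;
Leray 1934, (5.2)). [cite: Leray1934, (5.2] -/
theorem IsLerayHopfOn.eLpNorm_le_eLpNorm_datum (hu : IsLerayHopfOn T ν 0 u₀ u) (hν : 0 ≤ ν)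
    (hu₀ : MemLp u₀ 2 volume) {s : ℝ} (hs : s ∈ Icc 0 T) :
    eLpNorm (u s) 2 volume ≤ eLpNorm u₀ 2 volume := by
  obtain ⟨G, -, -, hE, -⟩ := hu.weakGrad_energy
  have h1 := hE s hs
  simp only [Pi.zero_apply, inner_zero_left, integral_zero, intervalIntegral.integral_zero,
    add_zero] at h1
  have hK : VectorCalculus.kineticEnergy (u s) ≤ VectorCalculus.kineticEnergy u₀ :=
    le_trans (le_add_of_nonneg_right (mul_nonneg hν ENNReal.toReal_nonneg)) h1
  have h2 : eEnergy (u s) ≤ eEnergy u₀ := by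
    rw [eEnergy_eq_ofReal _ (hu.memLp s hs), eEnergy_eq_ofReal _ hu₀]
    exact ENNReal.ofReal_le_ofReal (by linarith)
  rw [eEnergy_eq_eLpNorm_sq, eEnergy_eq_eLpNorm_sq] at h2
  exact (ENNReal.pow_le_pow_left_iff two_ne_zero).1 h2

omit [MeasurableSpace E] [BorelSpace E] [FiniteDimensional ℝ E] in
/-- In an orthonormal frame `b`: `⟪a, L a⟫ = Σᵢ ⟪⟪a, bᵢ⟫ a, L bᵢ⟫` (expand `a = Σᵢ ⟪a, bᵢ⟫ bᵢ`
inside `L`). [folklore] -/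
theorem inner_clm_apply_self_eq_sum {ι : Type*} [Fintype ι] (b : OrthonormalBasis ι ℝ E)
    (L : E →L[ℝ] E) (a : E) : ⟪a, L a⟫ = ∑ i, ⟪⟪a, b i⟫ • a, L (b i)⟫ := by
  conv_lhs => rw [← b.sum_repr' a]
  simp only [map_sum, map_smul, inner_sum, real_inner_smul_right, real_inner_smul_left]
  refine Finset.sum_congr rfl fun i _ => ?_
  rw [b.sum_repr' a, real_inner_comm (b i) a]

end Misc

end Literature.Analysis.FluidPDE
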